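import Summits.QuantumAdvantage.QuantumAdvantage.Theorems.WalkTwoStepDensePeelFrame

/-!
# (G♯) local engine — `DensePinned p` by INVOLUTION PEELING, 4/5: the local odd-row criterion; per-lift peeling and counting

See `WalkTwoStepDensePeelCylinder` (1/5) for the architecture.  THIS MODULE: §4b C4 `criterion` — for a usable position `τ` and a lift
`wt ≡ w3 (mod 3)` there is ONE residue `x (mod 3p)` such that the corner flip at `τ` changes the win bit on every input of the part with
the isolated-corner window pattern at `τ` and `N(τ) ≡ x` (odd row over the change sets `A h`: odd for the own cut, even for every
co-observer) — and §5a: `lift_bias_le` (peeling along `ℓ`-separated usable positions inside one lift), `card_not_peelEvent_le` (the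
cylinder count for peeling events), `effOn_le_card_usable_add` (effective cuts sit at usable positions up to `2d₀ + 4p + 3 + #pinTimes`).
-/

namespace Summit.QuantumAdvantage.AdviceFreeQNC0.LocalEngine

open Finset Classical
open Summit.QuantumAdvantage.AdviceFreeQNC0.Coset21.RungG (classOf)

namespace DensePeel

section Criterion

variable {p n : ℕ}

/-! #### C4 The criterion -/

/-- **The local odd-row criterion** (formerly `stub_criterion`). -/
theorem criterion [Fact p.Prime] (hp5 : 5 ≤ p) (c d₀ : ℕ) (S : TwoStep p n) (w : ZMod p) (u₀ : Fin n → Bool)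
    (τ : ℕ) (hτ : Usable c S d₀ w u₀ τ) (w3 : ℕ) :
    ∃ x : ℕ, x < 3 * p ∧ ∀ u ∈ part S d₀ w u₀, wt u % 3 = w3 → WinPat n d₀ τ u →
      wtPrefix u τ % (3 * p) = x → ringWinU c S.y (cornerFlip n τ u) ≠ ringWinU c S.y u := by
  obtain ⟨hlo, hhi, hpin, hs0, hsl, g₀, hg₀, u₁, hu₁, v₁, hv₁, hne⟩ := hτ
  have hprime : p.Prime := Fact.out
  -- the dead residue of the own cut
  set e : ℕ := (3 - (c + τ + w3) % 3) % 3 with he_def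
  have he3 : e < 3 := Nat.mod_lt _ (by norm_num)
  have hdead : (c + τ + w3 + e) % 3 = 0 := by omega
  -- the change sets
  let A : Fin (n + 1) → Finset (ZMod p) := fun h =>
    if h = g₀ then
      (if (∀ u' ∈ part S d₀ w u₀, ∀ v' ∈ part S d₀ w u₀, S.y g₀ u' = S.y g₀ v') then univ
        else (if τ < S.s g₀ then {aOf S w g₀} else {aOf S w g₀ + 1}))
    else
      (if (S.s h = τ ∧ S.α h ≠ S.β h ∧ liveC c τ w3 e h.val) then {aOf S w h, aOf S w h + 1} else ∅)
  have hodd : Odd (A g₀).card := by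
    simp only [A, if_true]
    split_ifs with hc hlt
    · rw [Finset.card_univ, ZMod.card]
      exact hprime.odd_of_ne_two (by omega)
    · simp
    · simp
  have heven : ∀ h, h ≠ g₀ → Even (A h).card := by
    intro h hh
    simp only [A, if_neg hh]
    by_cases hc : S.s h = τ ∧ S.α h ≠ S.β h ∧ liveC c τ w3 e h.val
    · rw [if_pos hc, Finset.card_pair ((succ_ne_self _).symm)]
      exact even_two
    · rw [if_neg hc]
      simp
  obtain ⟨ξ, hξ⟩ := exists_odd_fiber A g₀ hodd heven
  obtain ⟨x, hx3p, hxp, hx3⟩ := crt3 hprime hp5 ξ.val e (ZMod.val_lt ξ) he3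
  refine ⟨x, hx3p, ?_⟩
  intro u hu hW3 hpat hN
  have hF : Frame c d₀ S w u₀ τ w3 e ξ u :=
    { hp := by omega
      lo := hlo
      hi := hhi
      pin := hpin
      s0 := hs0
      sl := hsl
      mem := hu
      hw3 := hW3
      pat := hpat
      Np := by
        rw [← ZMod.natCast_mod, ← Nat.mod_mod_of_dvd (wtPrefix u τ) (dvd_mul_left p 3), hN, hxp,
          ZMod.natCast_zmod_val]
      N3 := by
        rw [← Nat.mod_mod_of_dvd (wtPrefix u τ) (dvd_mul_right 3 p), hN, hx3]
      dead := hdead }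
  -- the set of cuts whose status changes is `{h : ξ ∈ A h}`
  have hD : ((univ : Finset (Fin (n + 1))).filter fun h => status c S h u ≠ status c S h (cornerFlip n τ u))
      = (univ : Finset (Fin (n + 1))).filter fun h => ξ ∈ A h := by
    apply Finset.filter_congr
    intro h _
    by_cases hh : h = g₀
    · subst hh
      rw [hF.status_own_pre h hg₀, hF.status_own_post h hg₀]
      have e1 : (false ≠ S.y h (cornerFlip n τ u)) ↔ S.y h (cornerFlip n τ u) = true := by
        cases S.y h (cornerFlip n τ u) <;> simp
      rw [e1]
      simp only [A, if_true]
      by_cases hc : ∀ u' ∈ part S d₀ w u₀, ∀ v' ∈ part S d₀ w u₀, S.y h u' = S.y h v'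
      · rw [if_pos hc]
        exact iff_of_true (hF.y_own_post_of_const h hc hu₁ hv₁ hne) (Finset.mem_univ _)
      · rw [if_neg hc]
        exact hF.y_own_post_iff h hg₀ hc
    · have hhτ : h.val ≠ τ := fun hv => hh (Fin.ext (by rw [hv, hg₀]))
      simp only [A, if_neg hh]
      by_cases hs : S.s h = τ
      · by_cases hαβ : S.α h = S.β h
        · rw [hF.status_co_eq_of_alpha_eq_beta h hhτ hαβ, if_neg (fun h3 => h3.2.1 hαβ)]
          simp
        · rw [hF.status_co_iff h hhτ hs hαβ]
          by_cases hL : liveC c τ w3 e h.val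
          · rw [if_pos (show S.s h = τ ∧ S.α h ≠ S.β h ∧ liveC c τ w3 e h.val from ⟨hs, hαβ, hL⟩)]
            exact ⟨fun hh => hh.2, fun hh => ⟨hL, hh⟩⟩
          · rw [if_neg (fun h3 => hL h3.2.2)]
            exact iff_of_false (fun hh => hL hh.1) (Finset.notMem_empty _)
      · rw [status_cornerFlip_of_ne c S h τ u hhτ hs, if_neg (fun h3 => hs h3.1)]
        simp
  have hoddD : Odd (((univ : Finset (Fin (n + 1))).filter
      fun h => status c S h u ≠ status c S h (cornerFlip n τ u)).card) := by
    rw [hD]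
    exact hξ
  rw [← odd_sum_toNat_add_iff, Finset.sum_add_distrib, Nat.odd_add] at hoddD
  intro hEq
  rw [Bool.eq_iff_iff, ringWinU_eq_true_iff_odd_sum, ringWinU_eq_true_iff_odd_sum] at hEq
  rcases Nat.even_or_odd (∑ h : Fin (n + 1), (status c S h (cornerFlip n τ u)).toNat) with hv | hv
  · exact absurd hv (Nat.not_even_iff_odd.mpr (hEq.mpr (hoddD.mpr hv)))
  · exact absurd (hoddD.mp (hEq.mp hv)) (Nat.not_even_iff_odd.mpr hv)

end Criterion

/-! ### §5 Composition (PROVED): `DensePinned p` for every prime `p ≥ 5` -/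

section Composition

variable {p n : ℕ}

/-- Per lift `W ≡ w3 (mod 3)`: peeling along `ℓ`-separated usable positions. -/
theorem lift_bias_le [Fact p.Prime] (c d₀ : ℕ) (S : TwoStep p n) (w : ZMod p) (u₀ : Fin n → Bool) (w3 : ℕ)
    {k : ℕ} (pos : Fin k → ℕ) (hsep : ∀ i j : Fin k, i < j → pos i + ell p d₀ ≤ pos j)
    (hus : ∀ i, Usable c S d₀ w u₀ (pos i)) (x : Fin k → ℕ)
    (hx : ∀ i, ∀ u ∈ part S d₀ w u₀, wt u % 3 = w3 → WinPat n d₀ (pos i) u → wtPrefix u (pos i) % (3 * p) = x i →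
      ringWinU c S.y (cornerFlip n (pos i) u) ≠ ringWinU c S.y u) :
    |((((part S d₀ w u₀).filter fun u => wt u % 3 = w3).filter fun u => ringWinU c S.y u = true).card : ℝ)
        - ((((part S d₀ w u₀).filter fun u => wt u % 3 = w3).card : ℝ)) / 2|
      ≤ ((((univ : Finset (Fin n → Bool)).filter fun u => ∀ i, ¬ peelEvent n p d₀ (pos i) (x i) u).card : ℝ)) / 2 := by
  have hp1 : 1 ≤ p := (Fact.out : p.Prime).one_lt.le
  have hsep' : ∀ i j : Fin k, i ≠ j → pos i + ell p d₀ ≤ pos j ∨ pos j + ell p d₀ ≤ pos i := by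
    intro i j hij
    rcases lt_or_gt_of_ne hij with h | h
    · exact Or.inl (hsep i j h)
    · exact Or.inr (hsep j i h)
  have hcomm : ∀ i j (u : Fin n → Bool),
      cornerFlip n (pos i) (cornerFlip n (pos j) u) = cornerFlip n (pos j) (cornerFlip n (pos i) u) := by
    intro i j u
    by_cases hij : i = j
    · subst hij; rfl
    · have hs := hsep' i j hij
      exact cornerFlip_comm (by unfold ell at hs; omega) u
  have hE : ∀ i j (u : Fin n → Bool), i ≠ j →
      (peelEvent n p d₀ (pos j) (x j) (cornerFlip n (pos i) u) ↔ peelEvent n p d₀ (pos j) (x j) u) := by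
    intro i j u hij
    have hs := hsep' i j hij
    have hne : pos j ≠ pos i := by unfold ell at hs; omega
    unfold peelEvent
    rw [wtPrefix_cornerFlip (pos i) u hne]
    have hw : WinPat n d₀ (pos j) (cornerFlip n (pos i) u) ↔ WinPat n d₀ (pos j) u := by
      unfold WinPat
      refine forall_congr' fun i' => imp_congr_right fun h1 => imp_congr_right fun h2 => ?_
      rw [cornerFlip_apply_of_ne (pos i) u i' (by unfold ell at hs; omega) (by unfold ell at hs; omega)]
    rw [hw]
  have hmap : ∀ i ∈ List.finRange k, ∀ u ∈ (part S d₀ w u₀).filter (fun u => wt u % 3 = w3),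
      cornerFlip n (pos i) u ∈ (part S d₀ w u₀).filter (fun u => wt u % 3 = w3) := by
    intro i _ u hu
    rw [Finset.mem_filter] at hu ⊢
    obtain ⟨h1, h2, h3, -⟩ := hus i
    exact ⟨cornerFlip_mem_part S d₀ w u₀ (pos i) (by omega) (by omega) h3 u hu.1, by rw [wt_cornerFlip]; exact hu.2⟩
  have hflip : ∀ i ∈ List.finRange k, ∀ u ∈ (part S d₀ w u₀).filter (fun u => wt u % 3 = w3),
      peelEvent n p d₀ (pos i) (x i) u → ringWinU c S.y (cornerFlip n (pos i) u) ≠ ringWinU c S.y u := by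
    intro i _ u hu hev
    rw [Finset.mem_filter] at hu
    exact hx i u hu.1 hu.2 hev.1 hev.2
  have h := peel (fun u => ringWinU c S.y u) (fun i => cornerFlip n (pos i)) (fun i u => peelEvent n p d₀ (pos i) (x i) u)
    (fun i u => cornerFlip_cornerFlip n (pos i) u) hcomm hE (List.finRange k) _ hmap hflip
  refine le_trans h ?_
  gcongr
  intro u hu
  simp only [Finset.mem_filter, Finset.mem_univ, true_and] at hu ⊢
  exact fun i => hu.2 i (List.mem_finRange i)

/-- Counting the inputs that escape every peeling event. -/
theorem card_not_peelEvent_le (hp : 1 ≤ p) (d₀ : ℕ) {k : ℕ} (pos : Fin k → ℕ)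
    (hsep : ∀ i j : Fin k, i < j → pos i + ell p d₀ ≤ pos j)
    (hlo : ∀ i, d₀ + 3 * p ≤ pos i) (hhi : ∀ i, pos i + d₀ + 1 ≤ n) (x : Fin k → ℕ) (hx : ∀ i, x i < 3 * p) :
    ((((univ : Finset (Fin n → Bool)).filter fun u => ∀ i, ¬ peelEvent n p d₀ (pos i) (x i) u).card : ℝ))
      ≤ (2 : ℝ) ^ n * (1 - (1 / 2 : ℝ) ^ (ell p d₀)) ^ k := by
  have hsep'' : ∀ i j : Fin k, i < j → (pos i - d₀ - 3 * p) + ell p d₀ ≤ pos j - d₀ - 3 * p := by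
    intro i j hij
    have := hsep i j hij; have := hlo i; have := hlo j
    unfold ell at *
    omega
  have hn : ∀ i : Fin k, (pos i - d₀ - 3 * p) + ell p d₀ ≤ n := by
    intro i; have := hlo i; have := hhi i; unfold ell; omega
  have h := cylinder_count (n := n) (fun i => pos i - d₀ - 3 * p) hsep'' hn (fun i z b => blockEvent p d₀ (pos i) (x i) z b)
    (fun i z => blockEvent_reachable p d₀ (pos i) (x i) hp (hx i) (hlo i) z)
  refine le_trans ?_ h
  have hsub : ((univ : Finset (Fin n → Bool)).filter fun u => ∀ i, ¬ peelEvent n p d₀ (pos i) (x i) u)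
      ⊆ (univ : Finset (Fin n → Bool)).filter fun u => ∀ i,
          ¬ blockEvent p d₀ (pos i) (x i) (wtPrefix u (pos i - d₀ - 3 * p)) (blockBits u (pos i - d₀ - 3 * p) (ell p d₀)) := by
    intro u hu
    simp only [Finset.mem_filter, Finset.mem_univ, true_and] at hu ⊢
    exact fun i hb => hu i (peelEvent_of_blockEvent p d₀ (pos i) (x i) u hp (hlo i) (hhi i) hb)
  exact_mod_cast Finset.card_le_card hsub

/-- Effective cuts sit at usable positions, up to `2d₀ + 4p + 3 + #pinTimes` exceptions. -/
theorem effOn_le_card_usable_add (c d₀ : ℕ) (S : TwoStep p n) (w : ZMod p) (u₀ : Fin n → Bool) :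
    effOn c S (part S d₀ w u₀)
      ≤ (((univ : Finset (Fin (n + 1))).filter fun g => Usable c S d₀ w u₀ g.val).image Fin.val).card
        + (2 * d₀ + 4 * p + 3) + (pinTimes S d₀).card := by
  rw [Finset.card_image_of_injective _ Fin.val_injective]
  unfold effOn
  have hsub : ((univ : Finset (Fin (n + 1))).filter fun g =>
        ∃ u ∈ part S d₀ w u₀, ∃ v ∈ part S d₀ w u₀, status c S g u ≠ status c S g v)
      ⊆ ((univ : Finset (Fin (n + 1))).filter fun g => Usable c S d₀ w u₀ g.val)
        ∪ ((univ : Finset (Fin (n + 1))).filter fun g => g.val < d₀ + 3 * p)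
        ∪ ((univ : Finset (Fin (n + 1))).filter fun g => n < g.val + d₀ + p + 1)
        ∪ pinTimes S d₀
        ∪ ((univ : Finset (Fin (n + 1))).filter fun g => g.val = S.s 0)
        ∪ ((univ : Finset (Fin (n + 1))).filter fun g => g.val = S.s (Fin.last n)) := by
    intro g hg
    simp only [Finset.mem_filter, Finset.mem_univ, true_and] at hg
    by_contra hnot
    simp only [Finset.mem_union, Finset.mem_filter, Finset.mem_univ, true_and, not_or, not_lt] at hnot
    obtain ⟨⟨⟨⟨⟨hTU, hB1⟩, hB2⟩, hpin⟩, hB4⟩, hB5⟩ := hnot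
    apply hTU
    refine ⟨hB1, hB2, ?_, fun h => hB4 h.symm, fun h => hB5 h.symm, g, rfl, hg⟩
    intro t ht hte
    have : t = g := Fin.ext hte
    rw [this] at ht
    exact hpin ht
  have hB1 : (((univ : Finset (Fin (n + 1))).filter fun g => g.val < d₀ + 3 * p)).card ≤ d₀ + 3 * p := by
    have h := Finset.card_le_card_of_injOn (s := ((univ : Finset (Fin (n + 1))).filter fun g => g.val < d₀ + 3 * p))
      (t := Finset.range (d₀ + 3 * p)) (fun g : Fin (n + 1) => g.val) ?_ ?_
    · simpa using h
    · intro g hg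
      simp only [Finset.coe_filter, Finset.mem_univ, true_and, Set.mem_setOf_eq] at hg
      simpa using hg
    · intro i _ j _ h
      exact Fin.ext h
  have hB2 : (((univ : Finset (Fin (n + 1))).filter fun g => n < g.val + d₀ + p + 1)).card ≤ d₀ + p + 1 := by
    have h := Finset.card_le_card_of_injOn (s := ((univ : Finset (Fin (n + 1))).filter fun g => n < g.val + d₀ + p + 1))
      (t := Finset.range (d₀ + p + 1)) (fun g : Fin (n + 1) => n - g.val) ?_ ?_
    · simpa using h
    · intro g hg
      simp only [Finset.coe_filter, Finset.mem_univ, true_and, Set.mem_setOf_eq] at hg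
      simp only [Finset.coe_range, Set.mem_Iio]
      omega
    · intro i _ j _ h
      have := i.isLt; have := j.isLt
      apply Fin.ext
      simp only at h
      omega
  have hB4 : (((univ : Finset (Fin (n + 1))).filter fun g => g.val = S.s 0)).card ≤ 1 := by
    apply Finset.card_le_one.mpr
    intro a ha b hb
    simp only [Finset.mem_filter, Finset.mem_univ, true_and] at ha hb
    exact Fin.ext (ha.trans hb.symm)
  have hB5 : (((univ : Finset (Fin (n + 1))).filter fun g => g.val = S.s (Fin.last n))).card ≤ 1 := by
    apply Finset.card_le_one.mpr
    intro a ha b hb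
    simp only [Finset.mem_filter, Finset.mem_univ, true_and] at ha hb
    exact Fin.ext (ha.trans hb.symm)
  have u0 := Finset.card_le_card hsub
  have u5 := Finset.card_union_le
    (((univ : Finset (Fin (n + 1))).filter fun g => Usable c S d₀ w u₀ g.val)
        ∪ ((univ : Finset (Fin (n + 1))).filter fun g => g.val < d₀ + 3 * p)
        ∪ ((univ : Finset (Fin (n + 1))).filter fun g => n < g.val + d₀ + p + 1)
        ∪ pinTimes S d₀
        ∪ ((univ : Finset (Fin (n + 1))).filter fun g => g.val = S.s 0))
    (((univ : Finset (Fin (n + 1))).filter fun g => g.val = S.s (Fin.last n)))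
  have u4 := Finset.card_union_le
    (((univ : Finset (Fin (n + 1))).filter fun g => Usable c S d₀ w u₀ g.val)
        ∪ ((univ : Finset (Fin (n + 1))).filter fun g => g.val < d₀ + 3 * p)
        ∪ ((univ : Finset (Fin (n + 1))).filter fun g => n < g.val + d₀ + p + 1)
        ∪ pinTimes S d₀)
    (((univ : Finset (Fin (n + 1))).filter fun g => g.val = S.s 0))
  have u3 := Finset.card_union_le
    (((univ : Finset (Fin (n + 1))).filter fun g => Usable c S d₀ w u₀ g.val)
        ∪ ((univ : Finset (Fin (n + 1))).filter fun g => g.val < d₀ + 3 * p)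
        ∪ ((univ : Finset (Fin (n + 1))).filter fun g => n < g.val + d₀ + p + 1))
    (pinTimes S d₀)
  have u2 := Finset.card_union_le
    (((univ : Finset (Fin (n + 1))).filter fun g => Usable c S d₀ w u₀ g.val)
        ∪ ((univ : Finset (Fin (n + 1))).filter fun g => g.val < d₀ + 3 * p))
    (((univ : Finset (Fin (n + 1))).filter fun g => n < g.val + d₀ + p + 1))
  have u1 := Finset.card_union_le
    (((univ : Finset (Fin (n + 1))).filter fun g => Usable c S d₀ w u₀ g.val))
    (((univ : Finset (Fin (n + 1))).filter fun g => g.val < d₀ + 3 * p))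
  omega

end Composition

end DensePeel

end Summit.QuantumAdvantage.AdviceFreeQNC0.LocalEngine
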